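import Mathlib
import Literature.Topology.FourManifolds.PlanarAchiralWords
import Summits.SmoothPoincare4.SmoothPoincare4.Theorems.ConvexBisectionPlanarAcyclicBisectionRigidityStubWalkLow
import HarnessLib

/-!
# Crux `ConvexBisection.PlanarAcyclicBisectionRigidity`, line Sketch (skeleton v2.0) — helper
# `helper_exists_perfectBlock`

A kernel-checked certificate that the PERFECT SECTOR of the crux is inhabited at the block level
at `k = 5`: there is a positive planar word `A = (a₀, a₁, a₂, a₃)` of length `4` on the disc with
`4` holes, in in-range syntax, whose hole-set matrix is unimodular (`H₁(X_A; ℤ) = 0`,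
`Unimodular 4 A`) but whose curve classes do NOT normally generate `F₄` (`π₁(X_A) ≠ 1`,
`¬ NormallyGenerates 4 A`).  Pure algebra on the definitions of
`Literature/Topology/FourManifolds/PlanarAchiralWords.lean` (`PGen.data`, `evalWord`,
`PlanarCurve.cls`, `InRange`, `Unimodular`, `NormallyGenerates`), reusing the `ArcData` monoid laws
of the landed stub file `…StubWalkLow` (sub-namespace `WalkLow`: `aut_of`, `mul_one'`,
`evalWord_cons`).

* THE WITNESS (row 1 of the lead's census `PerfectBlocksK5.md` §2; written as a literal list,
  no constant is introduced for it):
  `A = ( σ₀⁻¹(c_[1,2]), σ₀(c_[1,3]), σ₀⁻²(c_[1,3]), σ₁⁻²(c_[2,3]) )`.  Its classes in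
  `F₄ = ⟨x₀, x₁, x₂, x₃⟩` are computed on the nose (`PerfectBlock.cls₀ … cls₃`):
  `x₁⁻¹x₀x₁x₂`, `x₀x₂x₃`, `x₁⁻¹x₀⁻¹x₁x₀x₁x₂x₃`, `x₂⁻¹x₁⁻¹x₂x₁x₂x₃`.
* UNIMODULAR (`PerfectBlock.unimodular`): abelianised, the classes are `g₀g₂`, `g₀g₂g₃`, `g₁g₂g₃`,
  `g₂g₃` (hole types `{0,2}, {0,2,3}, {1,2,3}, {2,3}`, determinant `1`), and
  `g₃ = (g₀g₂)⁻¹(g₀g₂g₃)`, `g₂ = (g₂g₃)g₃⁻¹`, `g₀ = (g₀g₂)g₂⁻¹`, `g₁ = (g₁g₂g₃)g₃⁻¹g₂⁻¹` put every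
  generator of `F₄ᵃᵇ` in the subgroup they generate.
* NOT NORMALLY GENERATING (`PerfectBlock.not_normallyGenerates`): the assignment
  `x₀ ↦ (0 1 2 3 4)`, `x₁ ↦ (0 2 4 3 1)`, `x₂ ↦ (0 3 1 2 4)`, `x₃ ↦ (0 2 3 1 4)` extends to a
  homomorphism `η : F₄ → S₅` (`PerfectBlock.exists_hom_perm_five`) killing the four classes (by
  `decide` in `Equiv.Perm (Fin 5)`) and not killing `x₀`; its kernel is a proper normal subgroup
  containing the classes, so their normal closure is not `F₄`.  (The quotient `F₄/⟪cls A⟫` is in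
  fact the binary icosahedral group `SL(2,5)` of order `120`, by a completed coset enumeration, and
  the image of `η` is `A₅`; only "`η` kills the classes and `η(x₀) ≠ 1`" is certified here, which is
  all the statement needs.)

Uses nothing unproved; no `native_decide`.
-/

noncomputable section

open Literature.Topology.FourManifolds Literature.Topology.FourManifolds.PlanarWords

-- the prescribed namespace `Summit.<S>.<P>.…` repeats `SmoothPoincare4` (S = P = SmoothPoincare4)
set_option linter.dupNamespace false

namespace Summit.SmoothPoincare4.SmoothPoincare4.Theorems.PlanarAcyclicBisectionRigidity.Sketch

namespace PerfectBlock

open ArcData PGen FreeGroup WalkLow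

/-! ## Round blocks, half-twists and the curve classes of the witness on four holes -/

/-- `x_[1,2] = x₁x₂` on four holes. [folklore] -/
theorem blockWord12 : blockWord 4 1 2 = of 1 * of 2 := by
  simp [blockWord, List.finRange_succ]

/-- `x_[1,3] = x₁x₂x₃` on four holes. [folklore] -/
theorem blockWord13 : blockWord 4 1 3 = of 1 * of 2 * of 3 := by
  simp [blockWord, List.finRange_succ, mul_assoc]

/-- `x_[2,3] = x₂x₃` on four holes. [folklore] -/
theorem blockWord23 : blockWord 4 2 3 = of 2 * of 3 := by
  simp [blockWord, List.finRange_succ]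

/-- Arc data of `σ₀⁻¹` on four holes: `π = (0 1)`, `u₁ = x₁⁻¹`. [folklore] -/
theorem data_sigma0_inv :
    data 4 (sigma 0 true) = ⟨Equiv.swap 0 1, fun i => if i = 1 then (of 1)⁻¹ else 1⟩ := rfl

/-- Arc data of `σ₀` on four holes: `π = (0 1)`, `u₀ = x₀`. [folklore] -/
theorem data_sigma0 :
    data 4 (sigma 0 false) = ⟨Equiv.swap 0 1, fun i => if i = 0 then of 0 else 1⟩ := rfl

/-- Arc data of `σ₁⁻¹` on four holes: `π = (1 2)`, `u₂ = x₂⁻¹`. [folklore] -/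
theorem data_sigma1_inv :
    data 4 (sigma 1 true) = ⟨Equiv.swap 1 2, fun i => if i = 2 then (of 2)⁻¹ else 1⟩ := rfl

/-- `[σ₀⁻¹(c_[1,2])] = x₁⁻¹x₀x₁x₂`. [folklore] -/
theorem cls₀ : PlanarCurve.cls 4 ⟨1, 2, [sigma 0 true]⟩ = (of 1)⁻¹ * of 0 * of 1 * of 2 := by
  simp [PlanarCurve.cls, evalWord_nil, data_sigma0_inv, blockWord12, Equiv.swap_apply_def,
    mul_assoc]

/-- `[σ₀(c_[1,3])] = x₀x₂x₃`. [folklore] -/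
theorem cls₁ : PlanarCurve.cls 4 ⟨1, 3, [sigma 0 false]⟩ = of 0 * of 2 * of 3 := by
  simp [PlanarCurve.cls, evalWord_nil, data_sigma0, blockWord13, Equiv.swap_apply_def, mul_assoc]

/-- `[σ₀⁻²(c_[1,3])] = x₁⁻¹x₀⁻¹x₁x₀x₁x₂x₃`. [folklore] -/
theorem cls₂ : PlanarCurve.cls 4 ⟨1, 3, [sigma 0 true, sigma 0 true]⟩ =
    (of 1)⁻¹ * (of 0)⁻¹ * of 1 * of 0 * of 1 * of 2 * of 3 := by
  simp [PlanarCurve.cls, evalWord_nil, data_sigma0_inv, blockWord13, Equiv.swap_apply_def,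
    mul_assoc]

/-- `[σ₁⁻²(c_[2,3])] = x₂⁻¹x₁⁻¹x₂x₁x₂x₃`. [folklore] -/
theorem cls₃ : PlanarCurve.cls 4 ⟨2, 3, [sigma 1 true, sigma 1 true]⟩ =
    (of 2)⁻¹ * (of 1)⁻¹ * of 2 * of 1 * of 2 * of 3 := by
  simp [PlanarCurve.cls, evalWord_nil, data_sigma1_inv, blockWord23, Equiv.swap_apply_def,
    mul_assoc]

/-! ## The witness `A = ( σ₀⁻¹(c_[1,2]), σ₀(c_[1,3]), σ₀⁻²(c_[1,3]), σ₁⁻²(c_[2,3]) )`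

The statements below are about the literal list (`PGen.sigma j true` is `σⱼ⁻¹`); no constant is
introduced for it, the helper being existential. -/

/-- The witness has the minimal length `4`. [folklore] -/
theorem length_word :
    ([⟨1, 2, [sigma 0 true]⟩, ⟨1, 3, [sigma 0 false]⟩, ⟨1, 3, [sigma 0 true, sigma 0 true]⟩,
      ⟨2, 3, [sigma 1 true, sigma 1 true]⟩] : List PlanarCurve).length = 4 := rfl

/-- Every curve of the witness is in in-range syntax on `4` holes. [folklore] -/
theorem inRange :
    ∀ c ∈ ([⟨1, 2, [sigma 0 true]⟩, ⟨1, 3, [sigma 0 false]⟩, ⟨1, 3, [sigma 0 true, sigma 0 true]⟩,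
      ⟨2, 3, [sigma 1 true, sigma 1 true]⟩] : List PlanarCurve), c.InRange 4 := by
  unfold PlanarCurve.InRange
  decide

/-! ## Unimodularity: the abelianised classes generate `F₄ᵃᵇ` -/

/-- A word is unimodular as soon as every subgroup of `F_nᵃᵇ` containing its abelianised classes
contains the generators `g_i = [x_i]`. [folklore] -/
theorem unimodular_of_forall_mem {n : ℕ} {A : List PlanarCurve}
    (h : ∀ H : Subgroup (Abelianization (FreeGroup (Fin n))),
      (∀ c ∈ A, Abelianization.of (PlanarCurve.cls n c) ∈ H) →
        ∀ i : Fin n, Abelianization.of (of i) ∈ H) :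
    Unimodular n A := by
  unfold Unimodular
  set H := Subgroup.closure {x | x ∈ A.map fun c => Abelianization.of (PlanarCurve.cls n c)}
  have gen : ∀ i : Fin n, Abelianization.of (of i) ∈ H :=
    h H fun c hc => Subgroup.subset_closure (List.mem_map.2 ⟨c, hc, rfl⟩)
  have key : ∀ x : FreeGroup (Fin n), Abelianization.of x ∈ H := by
    intro x
    induction x using FreeGroup.induction_on with
    | C1 => rw [_root_.map_one]; exact H.one_mem
    | of i => exact gen i
    | inv_of i ih => rw [_root_.map_inv]; exact H.inv_mem ih
    | mul x y hx hy => rw [_root_.map_mul]; exact H.mul_mem hx hy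
  rw [eq_top_iff]
  intro x _
  exact QuotientGroup.induction_on x key

/-- The hole-set matrix of the witness is unimodular: its abelianised classes `g₀g₂`, `g₀g₂g₃`,
`g₁g₂g₃`, `g₂g₃` generate `F₄ᵃᵇ ≅ ℤ⁴`. [folklore] -/
theorem unimodular :
    Unimodular 4
      [⟨1, 2, [sigma 0 true]⟩, ⟨1, 3, [sigma 0 false]⟩, ⟨1, 3, [sigma 0 true, sigma 0 true]⟩,
        ⟨2, 3, [sigma 1 true, sigma 1 true]⟩] := by
  refine unimodular_of_forall_mem fun H mem => ?_
  have h₀ := mem ⟨1, 2, [sigma 0 true]⟩ (by simp)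
  have h₁ := mem ⟨1, 3, [sigma 0 false]⟩ (by simp)
  have h₂ := mem ⟨1, 3, [sigma 0 true, sigma 0 true]⟩ (by simp)
  have h₃ := mem ⟨2, 3, [sigma 1 true, sigma 1 true]⟩ (by simp)
  rw [cls₀] at h₀
  rw [cls₁] at h₁
  rw [cls₂] at h₂
  rw [cls₃] at h₃
  simp only [_root_.map_mul, _root_.map_inv, inv_mul_cancel_comm, inv_mul_cancel, one_mul]
    at h₀ h₁ h₂ h₃
  -- h₀ : g₀g₂ ∈ H, h₁ : g₀g₂g₃ ∈ H, h₂ : g₁g₂g₃ ∈ H, h₃ : g₂g₃ ∈ H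
  have g₃ : Abelianization.of (of (3 : Fin 4)) ∈ H := by
    have := H.mul_mem (H.inv_mem h₀) h₁
    rwa [inv_mul_cancel_left] at this
  have g₂ : Abelianization.of (of (2 : Fin 4)) ∈ H := by
    have := H.mul_mem h₃ (H.inv_mem g₃)
    rwa [mul_inv_cancel_right] at this
  have g₀ : Abelianization.of (of (0 : Fin 4)) ∈ H := by
    have := H.mul_mem h₀ (H.inv_mem g₂)
    rwa [mul_inv_cancel_right] at this
  have g₁ : Abelianization.of (of (1 : Fin 4)) ∈ H := by
    have := H.mul_mem h₂ (H.inv_mem g₃)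
    rw [mul_inv_cancel_right] at this
    have := H.mul_mem this (H.inv_mem g₂)
    rwa [mul_inv_cancel_right] at this
  intro i
  fin_cases i <;> assumption

/-! ## The classes die under a non-trivial homomorphism `F₄ → S₅`: no normal generation -/

/-- A homomorphism `η : F₄ → S₅` killing the four classes of the witness but not `x₀`: the
extension of `x₀ ↦ (0 1 2 3 4)`, `x₁ ↦ (0 2 4 3 1)`, `x₂ ↦ (0 3 1 2 4)`, `x₃ ↦ (0 2 3 1 4)` (even
`5`-cycles, each given by its table of values and the table of its inverse, so that `decide`
evaluates words in them by table look-up; the image is `A₅`). [folklore] -/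
theorem exists_hom_perm_five :
    ∃ η : FreeGroup (Fin 4) →* Equiv.Perm (Fin 5), η (of 0) ≠ 1 ∧
      η (PlanarCurve.cls 4 ⟨1, 2, [sigma 0 true]⟩) = 1 ∧
      η (PlanarCurve.cls 4 ⟨1, 3, [sigma 0 false]⟩) = 1 ∧
      η (PlanarCurve.cls 4 ⟨1, 3, [sigma 0 true, sigma 0 true]⟩) = 1 ∧
      η (PlanarCurve.cls 4 ⟨2, 3, [sigma 1 true, sigma 1 true]⟩) = 1 := by
  refine ⟨FreeGroup.lift
    ![⟨![1, 2, 3, 4, 0], ![4, 0, 1, 2, 3], by decide, by decide⟩,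
      ⟨![2, 0, 4, 1, 3], ![1, 3, 0, 4, 2], by decide, by decide⟩,
      ⟨![3, 2, 4, 1, 0], ![4, 3, 1, 0, 2], by decide, by decide⟩,
      ⟨![2, 4, 3, 1, 0], ![4, 3, 0, 2, 1], by decide, by decide⟩], ?_, ?_, ?_, ?_, ?_⟩
  · simp only [FreeGroup.lift_apply_of]
    decide
  · rw [cls₀]
    simp only [_root_.map_mul, _root_.map_inv, FreeGroup.lift_apply_of]
    decide
  · rw [cls₁]
    simp only [_root_.map_mul, FreeGroup.lift_apply_of]
    decide
  · rw [cls₂]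
    simp only [_root_.map_mul, _root_.map_inv, FreeGroup.lift_apply_of]
    decide
  · rw [cls₃]
    simp only [_root_.map_mul, _root_.map_inv, FreeGroup.lift_apply_of]
    decide

/-- Curve classes killed by a homomorphism `η : F_n → G` that does not kill some `x` do not normally
generate `F_n` (their normal closure lies in `ker η ≠ F_n`). [folklore] -/
theorem not_normallyGenerates_of_hom {n : ℕ} {A : List PlanarCurve} {G : Type*} [Group G]
    (η : FreeGroup (Fin n) →* G) (hA : ∀ c ∈ A, η (PlanarCurve.cls n c) = 1)
    {x : FreeGroup (Fin n)} (hx : η x ≠ 1) : ¬ NormallyGenerates n A := by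
  intro hN
  unfold NormallyGenerates at hN
  have hle : Subgroup.normalClosure {y | y ∈ A.map (PlanarCurve.cls n)} ≤ η.ker := by
    refine Subgroup.normalClosure_le_normal ?_
    intro y hy
    obtain ⟨c, hc, rfl⟩ := List.mem_map.1 hy
    exact (MonoidHom.mem_ker).2 (hA c hc)
  rw [hN, top_le_iff] at hle
  exact hx ((MonoidHom.mem_ker).1 (hle ▸ Subgroup.mem_top x))

/-- The curve classes of the witness do NOT normally generate `F₄`: they die under a homomorphism
to `S₅` that does not kill `x₀`. [folklore] -/
theorem not_normallyGenerates :
    ¬ NormallyGenerates 4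
      [⟨1, 2, [sigma 0 true]⟩, ⟨1, 3, [sigma 0 false]⟩, ⟨1, 3, [sigma 0 true, sigma 0 true]⟩,
        ⟨2, 3, [sigma 1 true, sigma 1 true]⟩] := by
  obtain ⟨η, hη, η₀, η₁, η₂, η₃⟩ := exists_hom_perm_five
  refine not_normallyGenerates_of_hom η (fun c hc => ?_) hη
  simp only [List.mem_cons, List.not_mem_nil, or_false] at hc
  rcases hc with rfl | rfl | rfl | rfl
  · exact η₀
  · exact η₁
  · exact η₂
  · exact η₃

end PerfectBlock

/-- **Helper `helper_exists_perfectBlock`** (line Sketch, skeleton v2.0): the perfect sector of the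
crux is inhabited at the block level at `k = 5` — there is a positive planar word `A` of length `4`
on the disc with `4` holes, in in-range syntax, with unimodular hole-set matrix (`H₁(X_A; ℤ) = 0`)
whose curve classes do not normally generate `F₄` (`π₁(X_A) ≠ 1`; in fact `π₁(X_A) ↠ A₅`).
Witness: `A = ( σ₀⁻¹(c_[1,2]), σ₀(c_[1,3]), σ₀⁻²(c_[1,3]), σ₁⁻²(c_[2,3]) )`. [folklore] -/
theorem helper_exists_perfectBlock :
    ∃ A : List PlanarCurve, A.length = 4 ∧ (∀ c ∈ A, c.InRange 4) ∧ Unimodular 4 A ∧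
      ¬ NormallyGenerates 4 A :=
  ⟨_, PerfectBlock.length_word, PerfectBlock.inRange, PerfectBlock.unimodular,
    PerfectBlock.not_normallyGenerates⟩

end Summit.SmoothPoincare4.SmoothPoincare4.Theorems.PlanarAcyclicBisectionRigidity.Sketch

end
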